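import Literature.NumberTheory.CubicFields.DavenportBoundPosFibers
import HarnessLib

/-!
# Davenport's bound, negative discriminant: per-form inequalities and the `c`-fibres

`Proofs` file (theorems only), topic `Literature/NumberTheory/CubicFields`, the negative-discriminant
counterpart of `DavenportBoundPosFibers.lean` (H. Davenport, *On the class-number of binary cubic forms
II*, J. London Math. Soc. 26 (1951): `Σ_{0<−D<X} h(D) = (π²/24) X + O(X^{15/16})`; we only prove an upper
bound `O(X)`).  A Mathews-reduced form (`NegativeReduction.lean`) is `a(x − θy)(x − βy)(x − β̄y)` with
`β = u + iv ∈ 𝒟`; in the real coordinates `(θ, u, v)`: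
`b = −a(θ + 2u)`, `c = a(2θu + u² + v²)`, `d = −aθ(u² + v²)`, `−Disc = 4a⁴((θ − u)² + v²)² v²`
(`disc_witness`).  For `a ≥ 1` and `−Disc < X` we derive the box inequalities `a⁴ < 16X/27`,
`(a|θ − u|)⁴ < X/3`, `v⁶ < X/(4a⁴)`, `v² < 64X/b⁴` (when `|b| ≥ 2a`), `|d| ≤ (|b| + 2a)(u² + v²)`, and
the key fibre estimate: for fixed `(a, b, d)` two reduced forms have
`|c − c'| ≤ 2|b| + a + a|p − p'|` with `a|p − p'| ≤ 8a²|d|/b²` when `|b| ≥ 2a` (`p = u² + v² = d/(b + 2au)`),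
whence `#{c} ≤ 2V + 1` (`ncard_cFibre_neg_le_of_small`, `ncard_cFibre_neg_le_of_large`).

## References

* H. Davenport, *On the class-number of binary cubic forms II*, J. London Math. Soc. 26 (1951)
  192–198 [Davenport1951CubicFormsII].
-/

noncomputable section

namespace Literature.NumberTheory.CubicFields

namespace BinaryCubic

open Finset

/-! ### The discriminant in root coordinates -/

/-- **`Disc = −4a⁴((θ − u)² + v²)² v²`** for `a(x − θ)(x − β)(x − β̄)`, `β = u + iv`. [folklore] -/
theorem disc_witness (a θ u v : ℝ) :
    (⟨a, -a * (θ + 2 * u), a * (2 * θ * u + (u ^ 2 + v ^ 2)), -a * (θ * (u ^ 2 + v ^ 2))⟩ :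
      BinaryCubic ℝ).disc = -(4 * a ^ 4 * ((θ - u) ^ 2 + v ^ 2) ^ 2 * v ^ 2) := by
  rw [disc_eq]; ring

/-- The integral form with real witnesses `(θ, u, v)`: `−Disc f = 4a⁴((θ − u)² + v²)² v²`. [folklore] -/
theorem neg_disc_eq_of_witness {f : BinaryCubic ℤ} {θ u v : ℝ}
    (hb : (f.b : ℝ) = -f.a * (θ + 2 * u)) (hc : (f.c : ℝ) = f.a * (2 * θ * u + (u ^ 2 + v ^ 2)))
    (hd : (f.d : ℝ) = -f.a * (θ * (u ^ 2 + v ^ 2))) :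
    (-(f.disc : ℝ)) = 4 * (f.a : ℝ) ^ 4 * ((θ - u) ^ 2 + v ^ 2) ^ 2 * v ^ 2 := by
  have h1 : ((f.map (Int.castRingHom ℝ)).disc : ℝ) = (f.disc : ℝ) := by rw [disc_map, eq_intCast]
  have h2 : f.map (Int.castRingHom ℝ) =
      ⟨(f.a : ℝ), -f.a * (θ + 2 * u), f.a * (2 * θ * u + (u ^ 2 + v ^ 2)), -f.a * (θ * (u ^ 2 + v ^ 2))⟩ := by
    refine BinaryCubic.ext ?_ ?_ ?_ ?_ <;> simp [hb, hc, hd]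
  rw [← h1, h2, disc_witness]; ring

/-! ### Box inequalities for a reduced form with `0 < −Disc < X` -/

section Box

variable {a θ u v X : ℝ} (ha : 1 ≤ a) (hv : 0 < v) (hu : |u| ≤ 1 / 2) (hp : 1 ≤ u ^ 2 + v ^ 2)
  (hX : 4 * a ^ 4 * ((θ - u) ^ 2 + v ^ 2) ^ 2 * v ^ 2 < X)

include hu hp in
/-- `v² ≥ 3/4` (`u² ≤ 1/4`, `u² + v² ≥ 1`). [folklore] -/
theorem three_fourths_le_v_sq : 3 / 4 ≤ v ^ 2 := by
  have : u ^ 2 ≤ 1 / 4 := by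
    have h := abs_le.mp hu
    nlinarith [h.1, h.2]
  linarith

include hu in
/-- `u² ≤ 1/4`. [folklore] -/
theorem u_sq_le : u ^ 2 ≤ 1 / 4 := by
  have h := abs_le.mp hu
  nlinarith [h.1, h.2]

include ha hu hp hX in
/-- **`a⁴ < 16X/27`** (`−Disc ≥ 4a⁴v⁶ ≥ 27a⁴/16`). [cite: Davenport1951CubicFormsII, Lemma 1] -/
theorem a_pow_four_lt : a ^ 4 < 16 * X / 27 := by
  have hv2 := three_fourths_le_v_sq hu hp
  have h1 : 4 * a ^ 4 * (v ^ 2) ^ 3 ≤ 4 * a ^ 4 * ((θ - u) ^ 2 + v ^ 2) ^ 2 * v ^ 2 := by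
    have : (v ^ 2) ^ 3 ≤ ((θ - u) ^ 2 + v ^ 2) ^ 2 * v ^ 2 := by
      have h0 : 0 ≤ v ^ 2 := sq_nonneg v
      nlinarith [sq_nonneg (θ - u), mul_nonneg (sq_nonneg (θ - u)) h0, mul_nonneg (mul_nonneg (sq_nonneg (θ - u)) h0) h0]
    nlinarith [pow_nonneg (by linarith : (0 : ℝ) ≤ a) 4]
  have h2 : (3 / 4 : ℝ) ^ 3 ≤ (v ^ 2) ^ 3 := pow_le_pow_left₀ (by norm_num) hv2 3
  nlinarith [pow_nonneg (by linarith : (0 : ℝ) ≤ a) 4]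

include ha hu hp hX in
/-- **`(a|θ − u|)⁴ < X/3`** (`−Disc ≥ 4a⁴(θ − u)⁴ v² ≥ 3a⁴(θ − u)⁴`). [cite: Davenport1951CubicFormsII, Lemma 1] -/
theorem aw_pow_four_lt : (a * |θ - u|) ^ 4 < X / 3 := by
  have hv2 := three_fourths_le_v_sq hu hp
  have h1 : 4 * a ^ 4 * ((θ - u) ^ 2) ^ 2 * v ^ 2 ≤ 4 * a ^ 4 * ((θ - u) ^ 2 + v ^ 2) ^ 2 * v ^ 2 := by
    have ha4 : 0 ≤ 4 * a ^ 4 := by positivity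
    have : ((θ - u) ^ 2) ^ 2 * v ^ 2 ≤ ((θ - u) ^ 2 + v ^ 2) ^ 2 * v ^ 2 := by
      apply mul_le_mul_of_nonneg_right _ (sq_nonneg v)
      nlinarith [sq_nonneg (θ - u), sq_nonneg v]
    nlinarith
  have h3 : (a * |θ - u|) ^ 4 = a ^ 4 * ((θ - u) ^ 2) ^ 2 := by
    rw [mul_pow, show |θ - u| ^ 4 = (|θ - u| ^ 2) ^ 2 by ring, sq_abs]
  rw [h3]
  nlinarith [mul_nonneg (pow_nonneg (by linarith : (0 : ℝ) ≤ a) 4) (sq_nonneg ((θ - u) ^ 2))]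

include ha hX in
/-- **`v⁶ < X/(4a⁴)`** (`−Disc ≥ 4a⁴v⁶`). [folklore] -/
theorem v_pow_six_lt : v ^ 6 < X / (4 * a ^ 4) := by
  have ha4 : 0 < 4 * a ^ 4 := by positivity
  rw [lt_div_iff₀ ha4]
  have : v ^ 6 * (4 * a ^ 4) ≤ 4 * a ^ 4 * ((θ - u) ^ 2 + v ^ 2) ^ 2 * v ^ 2 := by
    have h0 : (v ^ 2) ^ 2 ≤ ((θ - u) ^ 2 + v ^ 2) ^ 2 :=
      pow_le_pow_left₀ (sq_nonneg v) (by nlinarith [sq_nonneg (θ - u)]) 2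
    nlinarith [mul_nonneg ha4.le (sq_nonneg v)]
  linarith

include ha hu hX in
/-- **`v² < 64X/b⁴` when `|b| ≥ 2a`** (`b = −a((θ − u) + 3u)`, so `|θ − u| ≥ |b|/a − 3/2 ≥ |b|/(4a)` and
`−Disc ≥ 4a⁴(θ − u)⁴v² ≥ b⁴v²/64`). [cite: Davenport1951CubicFormsII, §3] -/
theorem v_sq_lt_of_large (hb : 2 * a ≤ |-a * (θ + 2 * u)|) :
    v ^ 2 < 64 * X / (-a * (θ + 2 * u)) ^ 4 := by
  set b : ℝ := -a * (θ + 2 * u) with hbdef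
  have ha0 : 0 < a := by linarith
  have hb0 : 0 < |b| := by linarith
  -- `|b| ≤ a|θ - u| + (3/2) a`, hence `|b|/4 ≤ a |θ - u|`
  have hw : |b| ≤ a * |θ - u| + 3 / 2 * a := by
    have : b = -a * (θ - u) + -3 * a * u := by rw [hbdef]; ring
    rw [this]
    refine (abs_add_le _ _).trans ?_
    rw [abs_mul, abs_mul, abs_neg, abs_of_pos ha0, show |(-3 : ℝ) * a| = 3 * a by
      rw [abs_mul, abs_neg, abs_of_pos ha0]; norm_num]
    have := abs_le.mp hu
    have hu' : |u| ≤ 1 / 2 := hu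
    nlinarith [abs_nonneg u]
  have hw' : |b| / 4 ≤ a * |θ - u| := by linarith
  have h4 : (|b| / 4) ^ 4 ≤ (a * |θ - u|) ^ 4 := pow_le_pow_left₀ (by positivity) hw' 4
  have h3 : (a * |θ - u|) ^ 4 = a ^ 4 * ((θ - u) ^ 2) ^ 2 := by
    rw [mul_pow, show |θ - u| ^ 4 = (|θ - u| ^ 2) ^ 2 by ring, sq_abs]
  have h1 : 4 * (a ^ 4 * ((θ - u) ^ 2) ^ 2) * v ^ 2 ≤ 4 * a ^ 4 * ((θ - u) ^ 2 + v ^ 2) ^ 2 * v ^ 2 := by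
    have : ((θ - u) ^ 2) ^ 2 ≤ ((θ - u) ^ 2 + v ^ 2) ^ 2 :=
      pow_le_pow_left₀ (sq_nonneg _) (by nlinarith [sq_nonneg v]) 2
    have ha4 : 0 ≤ 4 * a ^ 4 * v ^ 2 := by positivity
    nlinarith
  have hb4 : 0 < b ^ 4 := by
    have := pow_pos hb0 4
    rwa [← abs_pow, abs_of_nonneg (by positivity : (0 : ℝ) ≤ b ^ 4)] at this
  rw [lt_div_iff₀ hb4]
  have : (|b| / 4) ^ 4 = b ^ 4 / 256 := by
    rw [div_pow, show |b| ^ 4 = (|b| ^ 2) ^ 2 by ring, sq_abs]; ring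
  rw [this] at h4
  rw [← h3] at h1
  nlinarith [mul_le_mul_of_nonneg_right h4 (sq_nonneg v), sq_nonneg v]

include ha hu in
/-- **`|d| ≤ (|b| + 2a)(u² + v²)`** (`d = −aθp`, `a|θ| ≤ a|θ − u| + a/2 ≤ |b| + 2a`). [folklore] -/
theorem abs_d_le : |-a * (θ * (u ^ 2 + v ^ 2))| ≤ (|-a * (θ + 2 * u)| + 2 * a) * (u ^ 2 + v ^ 2) := by
  have ha0 : 0 < a := by linarith
  have hp0 : 0 ≤ u ^ 2 + v ^ 2 := by positivity
  have hθ : a * |θ| ≤ |-a * (θ + 2 * u)| + 2 * a := by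
    have : a * θ = -(-a * (θ + 2 * u)) - 2 * a * u := by ring
    have h1 : a * |θ| = |a * θ| := by rw [abs_mul, abs_of_pos ha0]
    rw [h1, this]
    refine (abs_sub _ _).trans ?_
    have h2au : |2 * a * u| ≤ a := by
      rw [abs_mul, abs_of_pos (by positivity : (0 : ℝ) < 2 * a)]
      nlinarith [abs_nonneg u]
    rw [abs_neg]
    linarith
  rw [abs_mul, abs_neg, abs_of_pos ha0, abs_mul, abs_of_nonneg hp0, ← mul_assoc]
  exact mul_le_mul_of_nonneg_right hθ hp0

end Box

/-! ### The `c`-fibre: two reduced forms with the same `(a, b, d)` -/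

/-- **Two witnesses with the same `(a, b, d)`**: `c = −2bu − 4au² + ap` (`p = u² + v²`), so
`|c − c'| ≤ 2|b| + a + a|p − p'|`. [cite: Davenport1951CubicFormsII, §3] -/
theorem abs_c_sub_c_le {a b c₁ c₂ θ₁ u₁ p₁ θ₂ u₂ p₂ : ℝ} (ha : 0 < a)
    (hu₁ : |u₁| ≤ 1 / 2) (hu₂ : |u₂| ≤ 1 / 2)
    (hb₁ : b = -a * (θ₁ + 2 * u₁)) (hb₂ : b = -a * (θ₂ + 2 * u₂))
    (hc₁ : c₁ = a * (2 * θ₁ * u₁ + p₁)) (hc₂ : c₂ = a * (2 * θ₂ * u₂ + p₂)) :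
    |c₁ - c₂| ≤ 2 * |b| + a + a * |p₁ - p₂| := by
  have e₁ : c₁ = -2 * b * u₁ - 4 * a * u₁ ^ 2 + a * p₁ := by
    rw [hc₁]; have : a * θ₁ = -b - 2 * a * u₁ := by rw [hb₁]; ring
    linear_combination (2 * u₁) * this
  have e₂ : c₂ = -2 * b * u₂ - 4 * a * u₂ ^ 2 + a * p₂ := by
    rw [hc₂]; have : a * θ₂ = -b - 2 * a * u₂ := by rw [hb₂]; ring
    linear_combination (2 * u₂) * this
  have hdiff : c₁ - c₂ = -2 * b * (u₁ - u₂) - 4 * a * (u₁ ^ 2 - u₂ ^ 2) + a * (p₁ - p₂) := by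
    rw [e₁, e₂]; ring
  have h1 := abs_le.mp hu₁
  have h2 := abs_le.mp hu₂
  have hu12 : |u₁ - u₂| ≤ 1 := by rw [abs_le]; constructor <;> linarith
  have hsq : |u₁ ^ 2 - u₂ ^ 2| ≤ 1 / 4 := by
    rw [abs_le]; constructor <;> nlinarith
  rw [hdiff]
  have t1 : |-2 * b * (u₁ - u₂) - 4 * a * (u₁ ^ 2 - u₂ ^ 2) + a * (p₁ - p₂)| ≤
      |-2 * b * (u₁ - u₂) - 4 * a * (u₁ ^ 2 - u₂ ^ 2)| + |a * (p₁ - p₂)| := abs_add_le _ _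
  have t2 : |-2 * b * (u₁ - u₂) - 4 * a * (u₁ ^ 2 - u₂ ^ 2)| ≤
      |-2 * b * (u₁ - u₂)| + |4 * a * (u₁ ^ 2 - u₂ ^ 2)| := abs_sub _ _
  have hXb : |-2 * b * (u₁ - u₂)| ≤ 2 * |b| := by
    rw [abs_mul, abs_mul, abs_neg, abs_two]
    nlinarith [abs_nonneg b, abs_nonneg (u₁ - u₂), mul_le_mul_of_nonneg_left hu12 (abs_nonneg b)]
  have hYb : |4 * a * (u₁ ^ 2 - u₂ ^ 2)| ≤ a := by
    rw [abs_mul, abs_mul, abs_of_pos (by norm_num : (0 : ℝ) < 4), abs_of_pos ha]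
    nlinarith [abs_nonneg (u₁ ^ 2 - u₂ ^ 2)]
  have hZb : |a * (p₁ - p₂)| = a * |p₁ - p₂| := by rw [abs_mul, abs_of_pos ha]
  linarith

/-- **`a|p − p'| ≤ 8a²|d|/b²` when `|b| ≥ 2a`** (`p = d/(b + 2au)` with `|b + 2au| ≥ |b| − a ≥ |b|/2`).
[cite: Davenport1951CubicFormsII, §3] -/
theorem a_mul_abs_p_sub_p_le {a b d θ₁ u₁ p₁ θ₂ u₂ p₂ : ℝ} (ha : 0 < a) (hb : 2 * a ≤ |b|)
    (hu₁ : |u₁| ≤ 1 / 2) (hu₂ : |u₂| ≤ 1 / 2)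
    (hb₁ : b = -a * (θ₁ + 2 * u₁)) (hb₂ : b = -a * (θ₂ + 2 * u₂))
    (hd₁ : d = -a * (θ₁ * p₁)) (hd₂ : d = -a * (θ₂ * p₂)) :
    a * |p₁ - p₂| ≤ 8 * a ^ 2 * |d| / b ^ 2 := by
  -- `d = (b + 2 a uᵢ) pᵢ`
  have f₁ : d = (b + 2 * a * u₁) * p₁ := by rw [hd₁, hb₁]; ring
  have f₂ : d = (b + 2 * a * u₂) * p₂ := by rw [hd₂, hb₂]; ring
  have h1 := abs_le.mp hu₁
  have h2 := abs_le.mp hu₂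
  have hb0 : 0 < |b| := by linarith
  -- `|b + 2 a uᵢ| ≥ |b|/2`
  have hk : ∀ u : ℝ, |u| ≤ 1 / 2 → |b| / 2 ≤ |b + 2 * a * u| := by
    intro u hu
    have : |b| - |2 * a * u| ≤ |b + 2 * a * u| := by
      have := abs_sub_abs_le_abs_sub b (-(2 * a * u))
      rwa [abs_neg, sub_neg_eq_add] at this
    have h2au : |2 * a * u| ≤ a := by
      rw [abs_mul, abs_of_pos (by positivity : (0 : ℝ) < 2 * a)]
      nlinarith
    linarith
  have hk₁ := hk u₁ hu₁
  have hk₂ := hk u₂ hu₂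
  have hne₁ : b + 2 * a * u₁ ≠ 0 := fun h => by rw [h, abs_zero] at hk₁; linarith
  have hne₂ : b + 2 * a * u₂ ≠ 0 := fun h => by rw [h, abs_zero] at hk₂; linarith
  have hp₁ : p₁ = d / (b + 2 * a * u₁) := by rw [f₁]; field_simp
  have hp₂ : p₂ = d / (b + 2 * a * u₂) := by rw [f₂]; field_simp
  have hdiff : p₁ - p₂ = d * (2 * a * (u₂ - u₁)) / ((b + 2 * a * u₁) * (b + 2 * a * u₂)) := by
    rw [hp₁, hp₂]; field_simp; ring
  have hu12 : |u₂ - u₁| ≤ 1 := by rw [abs_le]; constructor <;> linarith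
  have hprod : (p₁ - p₂) * ((b + 2 * a * u₁) * (b + 2 * a * u₂)) = d * (2 * a * (u₂ - u₁)) := by
    rw [hp₁, hp₂]; field_simp; ring
  have habs : |p₁ - p₂| * (|b + 2 * a * u₁| * |b + 2 * a * u₂|) = |d| * (2 * a * |u₂ - u₁|) := by
    have := congrArg abs hprod
    simp only [abs_mul, abs_two, abs_of_pos ha] at this
    linarith [this]
  have hden : b ^ 2 / 4 ≤ |b + 2 * a * u₁| * |b + 2 * a * u₂| := by
    have : b ^ 2 / 4 = (|b| / 2) * (|b| / 2) := by rw [← sq_abs]; ring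
    rw [this]
    exact mul_le_mul hk₁ hk₂ (by positivity) (abs_nonneg _)
  have hb2 : 0 < b ^ 2 := by rw [← sq_abs]; exact pow_pos hb0 2
  have h1' : |p₁ - p₂| * (b ^ 2 / 4) ≤ |p₁ - p₂| * (|b + 2 * a * u₁| * |b + 2 * a * u₂|) :=
    mul_le_mul_of_nonneg_left hden (abs_nonneg _)
  have h2' : |d| * (2 * a * |u₂ - u₁|) ≤ |d| * (2 * a) := by
    have : 2 * a * |u₂ - u₁| ≤ 2 * a := by nlinarith [abs_nonneg (u₂ - u₁)]
    exact mul_le_mul_of_nonneg_left this (abs_nonneg d)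
  rw [le_div_iff₀ hb2]
  nlinarith [h1', h2', habs, abs_nonneg (p₁ - p₂), abs_nonneg d]

/-- **Integers within distance `V` of a fixed one**: a set of integers any two of which differ by at
most `V` has at most `2V + 1` elements. [folklore] -/
theorem ncard_le_of_diam {S : Set ℤ} {V : ℝ} (hV : 0 ≤ V)
    (h : ∀ c₁ ∈ S, ∀ c₂ ∈ S, |((c₁ : ℤ) : ℝ) - c₂| ≤ V) : (S.ncard : ℝ) ≤ 2 * V + 1 := by
  rcases S.eq_empty_or_nonempty with hS | ⟨c₀, hc₀⟩
  · rw [hS, Set.ncard_empty]; push_cast; linarith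
  · have hsub : S ⊆ {c : ℤ | (c₀ : ℝ) - V ≤ c ∧ (c : ℝ) ≤ c₀ + V} := by
      intro c hc
      have := abs_le.mp (h c hc c₀ hc₀)
      exact ⟨by linarith [this.1, this.2], by linarith [this.1, this.2]⟩
    have hfin : ({c : ℤ | (c₀ : ℝ) - V ≤ c ∧ (c : ℝ) ≤ c₀ + V}).Finite := by
      rw [int_mem_Icc_eq]; exact Finset.finite_toSet _
    calc (S.ncard : ℝ) ≤ (({c : ℤ | (c₀ : ℝ) - V ≤ c ∧ (c : ℝ) ≤ c₀ + V}).ncard : ℝ) := by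
          exact_mod_cast Set.ncard_le_ncard hsub hfin
      _ ≤ max ((c₀ : ℝ) + V - ((c₀ : ℝ) - V)) 0 + 1 := ncard_int_mem_Icc_le _ _
      _ = 2 * V + 1 := by rw [max_eq_left (by linarith)]; ring

/-- **The `c`-fibre, small `|b|`** (`|b| < 2a`): for fixed integers `(a, b, d)`, `a ≥ 1`, the reduced
forms `(a, b, c, d)` with `p = u² + v² ≤ M` number at most `2(2|b| + a + aM) + 1`.
[cite: Davenport1951CubicFormsII, §3] -/
theorem ncard_cFibre_neg_le_of_small (a b d : ℤ) (ha : 1 ≤ a) {M : ℝ} (hM : 1 ≤ M) :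
    (({c : ℤ | ∃ θ u v : ℝ, 0 < v ∧ |u| ≤ 1 / 2 ∧ 1 ≤ u ^ 2 + v ^ 2 ∧ u ^ 2 + v ^ 2 ≤ M ∧
        (b : ℝ) = -a * (θ + 2 * u) ∧ (c : ℝ) = a * (2 * θ * u + (u ^ 2 + v ^ 2)) ∧
        (d : ℝ) = -a * (θ * (u ^ 2 + v ^ 2))}).ncard : ℝ) ≤
      2 * (2 * |(b : ℝ)| + a + a * M) + 1 := by
  have haR : (0 : ℝ) < a := by exact_mod_cast (by omega : (0 : ℤ) < a)
  refine ncard_le_of_diam (by positivity) ?_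
  rintro c₁ ⟨θ₁, u₁, v₁, hv₁, hu₁, hp₁, hM₁, hb₁, hc₁, hd₁⟩ c₂ ⟨θ₂, u₂, v₂, hv₂, hu₂, hp₂, hM₂, hb₂, hc₂, hd₂⟩
  refine (abs_c_sub_c_le haR hu₁ hu₂ hb₁ hb₂ hc₁ hc₂).trans ?_
  have : |(u₁ ^ 2 + v₁ ^ 2) - (u₂ ^ 2 + v₂ ^ 2)| ≤ M := by
    rw [abs_le]; constructor <;> linarith
  nlinarith [this, abs_nonneg ((u₁ ^ 2 + v₁ ^ 2) - (u₂ ^ 2 + v₂ ^ 2))]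

/-- **The `c`-fibre, large `|b|`** (`|b| ≥ 2a`): for fixed integers `(a, b, d)`, `a ≥ 1`, the reduced
forms `(a, b, c, d)` number at most `2(2|b| + a + 8a²|d|/b²) + 1`. [cite: Davenport1951CubicFormsII, §3] -/
theorem ncard_cFibre_neg_le_of_large (a b d : ℤ) (ha : 1 ≤ a) (hb : 2 * (a : ℝ) ≤ |(b : ℝ)|) :
    (({c : ℤ | ∃ θ u v : ℝ, 0 < v ∧ |u| ≤ 1 / 2 ∧ 1 ≤ u ^ 2 + v ^ 2 ∧
        (b : ℝ) = -a * (θ + 2 * u) ∧ (c : ℝ) = a * (2 * θ * u + (u ^ 2 + v ^ 2)) ∧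
        (d : ℝ) = -a * (θ * (u ^ 2 + v ^ 2))}).ncard : ℝ) ≤
      2 * (2 * |(b : ℝ)| + a + 8 * (a : ℝ) ^ 2 * |(d : ℝ)| / (b : ℝ) ^ 2) + 1 := by
  have haR : (0 : ℝ) < a := by exact_mod_cast (by omega : (0 : ℤ) < a)
  refine ncard_le_of_diam (by positivity) ?_
  rintro c₁ ⟨θ₁, u₁, v₁, hv₁, hu₁, hp₁, hb₁, hc₁, hd₁⟩ c₂ ⟨θ₂, u₂, v₂, hv₂, hu₂, hp₂, hb₂, hc₂, hd₂⟩
  refine (abs_c_sub_c_le haR hu₁ hu₂ hb₁ hb₂ hc₁ hc₂).trans ?_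
  have := a_mul_abs_p_sub_p_le haR hb hu₁ hu₂ hb₁ hb₂ hd₁ hd₂
  linarith

end BinaryCubic

end Literature.NumberTheory.CubicFields

end
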